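import Mathlib
import HarnessLib
import Summits.Ventures.LatticeQCDFlow.Scoring.ChainEDFBand
import Summits.Ventures.LatticeQCDFlow.Scoring.FlowSamplerAutocorrelation

/-!
# The printed distribution function of ANY observable of the exact flow sampler on `SU(n)^E` has a
# certified uniform band from the flow-equation defect `δ` alone — UNCONDITIONAL, from any start:
# `P(sup_t |F_π(t) − F̂_N(t)| ≥ η) ≤ 2(⌈2/η⌉ + 1)·exp(−(Nη − 16e^{2δ})²/(128 N e^{4δ}))`

HONEST FRAMING: exact (Metropolis-corrected) sampling algorithms for lattice gauge theory;
figures of merit are autocorrelation/cost numbers at stated couplings and volumes; no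
continuum-physics claim.

Venture `LatticeQCDFlow` (cell pub-lqcd), topic `Scoring`; FANOUT row 4 (`s0-u1-b`, rung S0-B).
The composition of row 4's uniform band for the empirical distribution function along a Doeblin
chain (`Scoring/ChainEDFBand.chain_measureReal_exists_edf_dev_ge_le_of_pos`, any start) with the
tree's exact flow-MCMC theorem `Exactness.flowSampler_exact_doeblin` (rows 30/31: smooth action
`S`, jointly smooth flow action with uniform defect `δ` of Lüscher's flow equation on
`[0,1] × SU(n)^E`, `𝓕` integrating `−∂S̃_t`, model law `q = (𝓕_1)_* D[V]`; then there is a weight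
`w = dπ/dq` with `e^{−2δ} ≤ w ≤ e^{2δ}`, the kernel `indepMH q w` is EXACT for
`π = 𝒵⁻¹e^{−S}D[U]` and obeys Doeblin `K(U, ·) ≥ e^{−2δ} π`; UNCONDITIONAL via
`jacobianFormula_holds`).  **`flowSampler_edf_band`**: for EVERY initial law of the chain
`U_0, U_1, …` (cold start, hot start, a model draw), every measurable real observable `O`
(plaquette, Polyakov loop, topological charge, …), every `N ≥ 1` and `η > 0` with `Nη ≥ 16e^{2δ}`:
`P_{μ₀}(∃ t, η ≤ |F_π(t) − #{i<N : O(U_i) ≤ t}/N|) ≤ 2(⌈2/η⌉ + 1)·exp(−(Nη − 16e^{2δ})²/(128Ne^{4δ}))`,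
`F_π` the distribution function of `O` under the Boltzmann law.  Companion of
`Scoring/FlowSamplerConfidence` (time averages).  NEW WORK of the cell (composition); no definition.

Reading (value-free): a certified flow-equation defect is, by itself, an honest simultaneous band
for the histogram, distribution function and percentile table of every observable of the exact
flow sampler, Gaussian in `Nη²e^{−4δ}/128`, at every volume at which `δ` holds.  NOT CLAIMED: any
value of `δ` for a concrete flow; the thermalised (stationary-start) improvement; sharp constants.
-/

noncomputable section

namespace Summit.Ventures.LatticeQCDFlow.Scoring

open MeasureTheory ProbabilityTheory Filter Finset Preorder
open scoped ENNReal NNReal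

section Lattice

open Summit.Ventures.LatticeQCDFlow.Exactness
open Summit.Ventures.LatticeQCDFlow.Scoring.GlivenkoCantelli
open Literature.MathematicalPhysics.QuantumFieldTheory
open Literature.MathematicalPhysics.QuantumFieldTheory.Luscher2010
open Summit.Ventures.LatticeQCDFlow.TrivializingMaps
open scoped Matrix Matrix.Norms.Frobenius ContDiff

variable {d L n : ℕ} [NeZero L]

/-- **THE UNIFORM BAND FOR THE EXACT FLOW SAMPLER ON `SU(n)^E` — UNCONDITIONAL, FROM ANY START.**
Under the hypotheses of `flowSampler_exact_doeblin` (smooth `S`, jointly smooth flow action with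
uniform defect `δ` of Lüscher's equation, `q = (𝓕_1)_* D[V]`): with its weight `w` (`w · q = π`,
`K = indepMH q w` exact for `π = 𝒵⁻¹e^{−S}D[U]`), for EVERY initial law `μ₀`, every measurable
real observable `O`, every `N ≠ 0` and `η > 0` with `N η ≥ 16 e^{2δ}`:
`P_{μ₀}(∃ t, η ≤ |F_π(t) − #{i<N : O(U_i) ≤ t}/N|) ≤ 2(⌈2/η⌉ + 1)·exp(−(Nη − 16e^{2δ})²/(128Ne^{4δ}))`.
[ours] -/
theorem flowSampler_edf_band (B : SuBasis n)
    {S : AmbConfig d L n → ℝ} (hS : ContDiff ℝ ∞ S) {F : ℝ → AmbConfig d L n → ℝ}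
    (hF : ContDiff ℝ ∞ fun p : ℝ × AmbConfig d L n => F p.1 p.2)
    {Φ : ℝ → GaugeConfig d L (Matrix.specialUnitaryGroup (Fin n) ℂ) →
      GaugeConfig d L (Matrix.specialUnitaryGroup (Fin n) ℂ)}
    (hΦ : IsFlowMap (fun t W => -linkGrad B (F t) W) Φ) {c : ℝ → ℝ} {δ : ℝ}
    (hδ : ∀ t ∈ Set.Icc (0 : ℝ) 1, ∀ U : GaugeConfig d L (Matrix.specialUnitaryGroup (Fin n) ℂ),
      |luscherL B S t (F t) (WilsonFlow.coeConfig U) - S (WilsonFlow.coeConfig U) - c t| ≤ δ)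
    (q : Measure (GaugeConfig d L (Matrix.specialUnitaryGroup (Fin n) ℂ))) [IsProbabilityMeasure q]
    (hq : q = Measure.map (Φ 1) (trivialMeasure (Matrix.specialUnitaryGroup (Fin n) ℂ) d L)) :
    ∃ w : GaugeConfig d L (Matrix.specialUnitaryGroup (Fin n) ℂ) → ℝ, ∃ hw : Measurable w,
      (q.withDensity fun U => ENNReal.ofReal (w U)) =
        boltzmannMeasure (fun U : GaugeConfig d L (Matrix.specialUnitaryGroup (Fin n) ℂ) =>
          S (WilsonFlow.coeConfig U)) ∧
      Kernel.Invariant (indepMH q w)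
        (boltzmannMeasure fun U : GaugeConfig d L (Matrix.specialUnitaryGroup (Fin n) ℂ) =>
          S (WilsonFlow.coeConfig U)) ∧
      ∀ (μ₀ : Measure (GaugeConfig d L (Matrix.specialUnitaryGroup (Fin n) ℂ))) [IsProbabilityMeasure μ₀]
        (O : GaugeConfig d L (Matrix.specialUnitaryGroup (Fin n) ℂ) → ℝ), Measurable O →
        ∀ N : ℕ, N ≠ 0 → ∀ η : ℝ, 0 < η →
        let π := boltzmannMeasure fun U : GaugeConfig d L (Matrix.specialUnitaryGroup (Fin n) ℂ) =>
          S (WilsonFlow.coeConfig U)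
        16 * Real.exp (2 * δ) ≤ N * η →
        haveI : Fact (Measurable w) := ⟨hw⟩
        (Kernel.trajMeasure (X := fun _ : ℕ => GaugeConfig d L (Matrix.specialUnitaryGroup (Fin n) ℂ))
              μ₀ (fun m : ℕ => (indepMH q w).comap
                (fun y : (i : ↥(Finset.Iic m)) → GaugeConfig d L (Matrix.specialUnitaryGroup (Fin n) ℂ) =>
                  y ⟨m, Finset.mem_Iic.2 le_rfl⟩) (measurable_pi_apply _))).real
            {x | ∃ t : ℝ, η ≤ |cdf (π.map O) t
                - (∑ i ∈ Finset.range N, (Set.Iic t).indicator (1 : ℝ → ℝ) (O (x i))) / N|}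
          ≤ 2 * ((⌈2 / η⌉₊ : ℝ) + 1)
              * Real.exp (-(N * η - 16 * Real.exp (2 * δ)) ^ 2 / (128 * N * Real.exp (4 * δ))) := by
  obtain ⟨w, hw, -, -, hπ, hinv, -, hdoeb⟩ := flowSampler_exact_doeblin B hS hF hΦ hδ q hq
  haveI : Fact (Measurable w) := ⟨hw⟩
  have hS'c : Continuous fun U : GaugeConfig d L (Matrix.specialUnitaryGroup (Fin n) ℂ) =>
      S (WilsonFlow.coeConfig U) := hS.continuous.comp WilsonFlow.continuous_coeConfig
  haveI := isProbabilityMeasure_boltzmannMeasure (d := d) (L := L) hS'c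
  have hε0 : 0 < ENNReal.ofReal (Real.exp (-(2 * δ))) := ENNReal.ofReal_pos.2 (Real.exp_pos _)
  refine ⟨w, hw, hπ, hinv, fun μ₀ _ O hO N hN η hη hs => ?_⟩
  have hr : (ENNReal.ofReal (Real.exp (-(2 * δ)))).toReal = Real.exp (-(2 * δ)) :=
    ENNReal.toReal_ofReal (Real.exp_pos _).le
  have h16 : 16 / (ENNReal.ofReal (Real.exp (-(2 * δ)))).toReal = 16 * Real.exp (2 * δ) := by
    rw [hr, Real.exp_neg, div_inv_eq_mul]
  have hs' : 16 / (ENNReal.ofReal (Real.exp (-(2 * δ)))).toReal ≤ N * η := by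
    rw [h16]
    exact hs
  have h := chain_measureReal_exists_edf_dev_ge_le_of_pos (κ := indepMH q w) (μ₀ := μ₀) hinv
    (fun x B hB => hdoeb x hB) hε0 hO hN hη hs'
  have h8 : (ENNReal.ofReal (Real.exp (-(2 * δ)))).toReal ^ 2 = (Real.exp (4 * δ))⁻¹ := by
    rw [hr, ← Real.exp_nat_mul, ← Real.exp_neg]
    congr 1
    push_cast
    ring
  rw [h16, h8, div_inv_eq_mul] at h
  exact h

end Lattice

end Summit.Ventures.LatticeQCDFlow.Scoring

end
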